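import Summits.AtomisticToContinuum.Crystallization.Theorems.PhononSlackCertificatesCoerciveTwoShellGapPeriodisation

/-!
# Crux `PhononSlackCertificates.NearFarGlueR` (stmt-AtomisticToContinuum-14970), line `Sketch`:
# stub `stub_sepTightOfTorus` — TIGHT-CONTACT COUNT, TRANSFER TORUS → FINITE (separation `3/10`)

The crux-sized residual of the line (the "tight contact gap") charges, in every `δ`-separated
finite configuration, `g₂ > 0` per TIGHT CONTACT — a `1/20`-bad particle within `21/20` of a
`1/20`-good one — above `N · e*` (`e* = ⨅_Q e(Q)`, the periodic Lennard-Jones infimum); it is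
equivalent to its instance `δ = 3/10`.  This file is one half of its TORUS FORM: IF one `g > 0`
charges every tight motif point of every periodic configuration `P` of `ℝ³` with
`3/10`-separated point set (`e* + g · #T(motif)/#motif ≤ e(P)`, tightness of a motif point `y`
read in the infinite set `P.points`: `y` is set-bad, `¬ IsTwoShellGoodSet (1/20) (47/50) 1 P.points y`,
and some set-good `z ∈ P.points` lies within `21/20` of `y`), THEN the same `g` charges every
tight index of every finite `3/10`-separated `x : Fin N → ℝ³`:
`N · e* + g · #{j : j bad, some good i with dist (x i) (x j) ≤ 21/20} ≤ E_LJ(x)`.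

PROOF (far periodisation; a port of `CoerciveTwoShellGapPeriodisation.stub_periodisation`, the
same transfer for the bad count at separation `1/3`).  For `N ≥ 1` take a periodic configuration
`P` with motif `univ.image x` all of whose non-zero periods have length `≥ 2Σ‖xᵢ‖ + 2`
(`CoarseTierTransfer.exists_periodicConfiguration`).  Then `P.points` is `3/10`-separated
(`separated_points_three_tenths`), `#motif = N`, `e(P) ≤ E_LJ(x)/N` (`energyPerParticle_le`),
set-goodness at `x i` gives index-goodness of `i` (landed,
`CoerciveTwoShellGapPeriodisation.isTwoShellGood_of_isTwoShellGoodSet`) and — the only new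
point — conversely an index-goodness witness `(a, A, Pat, f)` of `i` gives the set-goodness
witness `(a, A, Pat, x ∘ f)` of `x i` in `P.points` (`isTwoShellGoodSet_of_isTwoShellGood_far`):
a point of `P` within `3a/2 ≤ 3/2 < 2` of `x i` is some `x j` (the other points of `P` are at
distance `≥ 2`, `two_le_dist_of_mem_points`), `j ≠ i`, and the index coverage supplies `v` with
`f v = j`.  Hence a tight index `j` (bad, with a good `i` within `21/20`) gives the tight motif
point `x j` (set-bad by the landed direction, with the set-good `x i ∈ P.points` within `21/20`),
injectively (`card_tight_le`); feed `P` to the hypothesis and multiply by `N`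
(`mul_add_le_of_add_div_le`); `N = 0` is trivial.  No definition, no named fact; all `[folklore]`.
-/

noncomputable section

namespace Summit.AtomisticToContinuum.Crystallization.Theorems.PhononSlackCertificatesNearFarGlueR

open scoped BigOperators Classical
open Literature.MathematicalPhysics.StatisticalMechanics Literature.Geometry.DiscreteGeometry
open Summit.AtomisticToContinuum.Crystallization.Theorems.CoarseTierTransfer
open Summit.AtomisticToContinuum.Crystallization.Theorems.CoerciveTwoShellGapPeriodisation
  (isTwoShellGood_of_isTwoShellGoodSet)

-- adapted from Summits/.../PhononSlackCertificatesCoerciveTwoShellGapPeriodisation.lean (stub_periodisation)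
-- and Summits/.../ReggeStarCoercivityStarCoercivityCoarseTierTransfer.lean (separated_points, injective_of_separated)

variable {N : ℕ} {x : Fin N → EuclideanSpace ℝ (Fin 3)} {P : PeriodicConfiguration 3}

/-- **`P.points` is `3/10`-separated when `x` is** (far periodisation: motif `univ.image x`,
non-zero periods of length `≥ 2Σ‖xᵢ‖ + 2`).  Two distinct points `xᵢ + g` and `v`: after
translating by the period `−g`, either `v − g = xⱼ` with `j ≠ i` (distance `dist xᵢ xⱼ ≥ 3/10`),
or `v − g` is not a motif point and lies at distance `≥ 2` from `xᵢ`. [folklore] -/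
theorem separated_points_three_tenths (hPm : P.motif = Finset.univ.image x)
    (hPl : ∀ g ∈ P.lattice, g ≠ 0 → 2 * ∑ k, ‖x k‖ + 2 ≤ ‖g‖)
    (hsep : ∀ i j : Fin N, i ≠ j → (3 / 10 : ℝ) ≤ dist (x i) (x j)) :
    ∀ u ∈ P.points, ∀ v ∈ P.points, u ≠ v → (3 / 10 : ℝ) ≤ dist u v := by
  rintro u ⟨z, hz, g, hg, rfl⟩ v hv huv
  rw [hPm] at hz
  obtain ⟨i, -, rfl⟩ := Finset.mem_image.1 hz
  have hv' : v - g ∈ P.points := by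
    have h := P.add_mem_points hv (P.lattice.neg_mem hg)
    simpa [sub_eq_add_neg] using h
  have hdist : dist (x i + g) v = dist (x i) (v - g) := by
    rw [dist_eq_norm, dist_eq_norm]
    congr 1
    abel
  rw [hdist]
  by_cases h : ∃ j, v - g = x j
  · obtain ⟨j, hj⟩ := h
    rw [hj]
    refine hsep i j ?_
    rintro rfl
    exact huv (sub_eq_iff_eq_add.1 hj).symm
  · push Not at h
    have h2 := two_le_dist_of_mem_points hPm hPl i hv' h
    linarith

/-- A `3/10`-separated configuration is injective (coincident points are at distance `0 < 3/10`).
[folklore] -/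
theorem injective_of_separated_three_tenths
    (hsep : ∀ i j : Fin N, i ≠ j → (3 / 10 : ℝ) ≤ dist (x i) (x j)) : Function.Injective x := by
  intro i j hij
  by_contra hne
  have h := hsep i j hne
  rw [hij, dist_self] at h
  norm_num at h

/-- **Transfer of goodness, index → set** (the converse of
`CoerciveTwoShellGapPeriodisation.isTwoShellGood_of_isTwoShellGoodSet`).  For a far periodisation
`P` of the injective `x` (motif `univ.image x`, non-zero periods of length `≥ 2Σ‖xᵢ‖ + 2`), an
index-goodness witness `(a, A, Pat, f)` of `i` in `x` gives the set-goodness witness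
`(a, A, Pat, x ∘ f)` of `x i` in `P.points`: membership because the motif is the image of `x`,
injectivity from that of `x` and of `f` on `Pat`, and two-way coverage because a point of `P`
within `3a/2 ≤ 3/2 < 2` of `x i` is some `x j` (the other points of `P` are at distance `≥ 2`),
`j ≠ i`, matched by the index coverage. [folklore] -/
theorem isTwoShellGoodSet_of_isTwoShellGood_far (hPm : P.motif = Finset.univ.image x)
    (hPl : ∀ g ∈ P.lattice, g ≠ 0 → 2 * ∑ k, ‖x k‖ + 2 ≤ ‖g‖) (hx : Function.Injective x)
    (i : Fin N) (h : IsTwoShellGood (1 / 20) (47 / 50) 1 x i) :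
    IsTwoShellGoodSet (1 / 20) (47 / 50) 1 P.points (x i) := by
  obtain ⟨a, ha₁, ha₂, A, Pat, f, hPat, hf, hinj, hcov⟩ := h
  have hmem : ∀ j : Fin N, x j ∈ P.points := fun j =>
    P.mem_points_of_mem_motif (by rw [hPm]; exact Finset.mem_image_of_mem x (Finset.mem_univ j))
  refine ⟨a, ha₁, ha₂, A, Pat, fun v => x (f v), hPat, fun v hv => ⟨hmem (f v), (hf v hv).2⟩,
    ?_, ?_⟩
  · intro v hv w hw hvw
    exact hinj hv hw (hx hvw)
  · intro y hy hyi hd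
    -- `y` is within `3a/2 ≤ 3/2 < 2` of `x i`, hence of the form `x j`
    have hex : ∃ j, y = x j := by
      by_contra hno
      push Not at hno
      have h2 := two_le_dist_of_mem_points hPm hPl i hy hno
      rw [dist_comm] at hd
      linarith
    obtain ⟨j, rfl⟩ := hex
    have hji : j ≠ i := fun hji => hyi (by rw [hji])
    obtain ⟨v, hv, hfv⟩ := hcov j hji hd
    exact ⟨v, hv, by simp only [hfv]⟩

/-- **The tight indices of `x` are counted by the tight motif points of its far periodisation
`P`**: `#{j : j bad, ∃ good i, dist (x i) (x j) ≤ 21/20} ≤ #{y ∈ motif : y set-bad, ∃ set-good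
z ∈ P.points, dist z y ≤ 21/20}` (motif `= univ.image x`, `x` injective): `x j` is set-bad by
`isTwoShellGood_of_isTwoShellGoodSet`, and `z := x i ∈ P.points` is set-good by
`isTwoShellGoodSet_of_isTwoShellGood_far`. [folklore] -/
theorem card_tight_le (hPm : P.motif = Finset.univ.image x)
    (hPl : ∀ g ∈ P.lattice, g ≠ 0 → 2 * ∑ k, ‖x k‖ + 2 ≤ ‖g‖) (hx : Function.Injective x) :
    Nat.card {j : Fin N // ¬ IsTwoShellGood (1 / 20) (47 / 50) 1 x j ∧
        ∃ i : Fin N, IsTwoShellGood (1 / 20) (47 / 50) 1 x i ∧ dist (x i) (x j) ≤ 21 / 20} ≤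
      (P.motif.filter fun y => ¬ IsTwoShellGoodSet (1 / 20) (47 / 50) 1 P.points y ∧
        ∃ z ∈ P.points, IsTwoShellGoodSet (1 / 20) (47 / 50) 1 P.points z ∧
          dist z y ≤ 21 / 20).card := by
  have hPm' : P.motif = Finset.univ.image x := hPm
  have hmem : ∀ j : Fin N, x j ∈ P.points := fun j =>
    P.mem_points_of_mem_motif (by rw [hPm]; exact Finset.mem_image_of_mem x (Finset.mem_univ j))
  rw [hPm', Finset.filter_image, Finset.card_image_of_injective _ hx, Nat.card_eq_fintype_card,
    Fintype.card_subtype]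
  refine Finset.card_le_card fun j => ?_
  simp only [Finset.mem_filter, Finset.mem_univ, true_and]
  rintro ⟨hbad, i, hgood, hd⟩
  exact ⟨fun hset => hbad (isTwoShellGood_of_isTwoShellGoodSet hPm hPl hx j hset),
    x i, hmem i, isTwoShellGoodSet_of_isTwoShellGood_far hPm hPl hx i hgood, hd⟩

/-- **Stub `stub_sepTightOfTorus` — tight-contact count, transfer torus → finite** of line
`Sketch` (crux `PhononSlackCertificates.NearFarGlueR`, item 14970).  If some `g > 0` charges
every tight motif point of every periodic configuration of `ℝ³` with `3/10`-separated point set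
(`e* + g · #T(motif)/#motif ≤ e(P)`; a motif point `y` is tight when it is `1/20`-bad in
`P.points` and some `1/20`-good `z ∈ P.points` has `dist z y ≤ 21/20`), then some `g₂ > 0`
(namely `g`) gives, for every `3/10`-separated finite `x : Fin N → ℝ³`,
`N · e* + g₂ · #{j : ¬ good j ∧ ∃ i, good i ∧ dist (x i) (x j) ≤ 21/20} ≤ E_LJ(x)`.
Proof: apply the hypothesis to a far periodisation of `x` (periods `≥ 2Σ‖xᵢ‖ + 2`: separated by
`separated_points_three_tenths`, `#tight(x) ≤ #tight motif points` by `card_tight_le`,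
`#motif = N`, `e(P) ≤ E_LJ(x)/N`) and multiply by `N`; `N = 0` is trivial. [folklore] -/
theorem stub_sepTightOfTorus :
    (∃ g : ℝ, 0 < g ∧ ∀ P : PeriodicConfiguration 3,
      (∀ u ∈ P.points, ∀ v ∈ P.points, u ≠ v → (3 / 10 : ℝ) ≤ dist u v) →
      (⨅ Q : PeriodicConfiguration 3, Q.energyPerParticle lennardJones)
        + g * ((P.motif.filter fun y => ¬ IsTwoShellGoodSet (1 / 20) (47 / 50) 1 P.points y ∧
            ∃ z ∈ P.points, IsTwoShellGoodSet (1 / 20) (47 / 50) 1 P.points z ∧ dist z y ≤ 21 / 20).card : ℝ)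
          / (P.motif.card : ℝ)
        ≤ P.energyPerParticle lennardJones) →
    ∃ g₂ : ℝ, 0 < g₂ ∧ ∀ (N : ℕ) (x : Fin N → EuclideanSpace ℝ (Fin 3)),
      (∀ i j : Fin N, i ≠ j → (3 / 10 : ℝ) ≤ dist (x i) (x j)) →
      (N : ℝ) * (⨅ Q : PeriodicConfiguration 3, Q.energyPerParticle lennardJones)
        + g₂ * (Nat.card {j : Fin N // ¬ IsTwoShellGood (1 / 20) (47 / 50) 1 x j ∧
            ∃ i : Fin N, IsTwoShellGood (1 / 20) (47 / 50) 1 x i ∧ dist (x i) (x j) ≤ 21 / 20} : ℝ)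
        ≤ interactionEnergy lennardJones x := by
  rintro ⟨g, hg, hP⟩
  refine ⟨g, hg, fun N x hsep => ?_⟩
  rcases Nat.eq_zero_or_pos N with rfl | hN
  · simp [interactionEnergy]
  · have hx : Function.Injective x := injective_of_separated_three_tenths hsep
    obtain ⟨P, hPm, hPl⟩ := exists_periodicConfiguration x hN
    have key := hP P (separated_points_three_tenths hPm hPl hsep)
    have hcardm : (P.motif.card : ℝ) = N := by
      rw [hPm, Finset.card_image_of_injective _ hx]
      simp
    rw [hcardm] at key
    have hcnt : (Nat.card {j : Fin N // ¬ IsTwoShellGood (1 / 20) (47 / 50) 1 x j ∧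
          ∃ i : Fin N, IsTwoShellGood (1 / 20) (47 / 50) 1 x i ∧ dist (x i) (x j) ≤ 21 / 20} : ℝ) ≤
        ((P.motif.filter fun y => ¬ IsTwoShellGoodSet (1 / 20) (47 / 50) 1 P.points y ∧
          ∃ z ∈ P.points, IsTwoShellGoodSet (1 / 20) (47 / 50) 1 P.points z ∧
            dist z y ≤ 21 / 20).card : ℝ) := by
      exact_mod_cast card_tight_le hPm hPl hx
    have h2 := energyPerParticle_le hPm hPl hx hN
    have hNr : (0 : ℝ) < N := by exact_mod_cast hN
    refine mul_add_le_of_add_div_le hNr (le_trans ?_ (key.trans h2))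
    have h3 : g * (Nat.card {j : Fin N // ¬ IsTwoShellGood (1 / 20) (47 / 50) 1 x j ∧
          ∃ i : Fin N, IsTwoShellGood (1 / 20) (47 / 50) 1 x i ∧ dist (x i) (x j) ≤ 21 / 20} : ℝ)
            / N ≤
        g * ((P.motif.filter fun y => ¬ IsTwoShellGoodSet (1 / 20) (47 / 50) 1 P.points y ∧
          ∃ z ∈ P.points, IsTwoShellGoodSet (1 / 20) (47 / 50) 1 P.points z ∧
            dist z y ≤ 21 / 20).card : ℝ) / N :=
      div_le_div_of_nonneg_right (mul_le_mul_of_nonneg_left hcnt hg.le) hNr.le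
    linarith

end Summit.AtomisticToContinuum.Crystallization.Theorems.PhononSlackCertificatesNearFarGlueR

end
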